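import Summits.AtomisticToContinuum.FouriersLaw.Theorems.JunctionLocalityNonBallisticLightConeAssemblyPart2f
import Summits.AtomisticToContinuum.FouriersLaw.Theorems.JunctionLocalityNonBallisticContactCurrentFourthMoment

/-!
# `NonBallistic` / STUB LC `stub_lightConeWindow`: the light-cone window by the synchronous coupling

STUB LC of line `contact-current-forgetting`, crux `NonBallistic` (`--supports stmt-AtomisticToContinuum-9127`), the
registered text VERBATIM: a light-cone window for the extreme Green–Kubo entry — `t₀(N) → ∞`, `η_N t₀(N) → 0`,
`|M_N(0,N−2)(t)| ≤ η_N` on `[0, t₀(N)]`.  Almost-finite propagation speed by the synchronous coupling: the assembly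
`FSAssembly.stub_lightConeWindow_of_fourthMoment` (parts 1, 2a–2f: propagation bound `chainFlow_momentumFlip_propagation`,
kinematics, momentum tail, Gibbs energy tail, single-flip estimate, double flip, Jensen, pairing with the contact flip)
fed with the last static input, the `N`-uniform fourth Gibbs moment of the bond currents
`pinnedChain_contactCurrentFourthMoment` (FS-D2).
-/

noncomputable section

namespace Summit.AtomisticToContinuum.FouriersLaw.Theorems.NonBallistic

open MeasureTheory ProbabilityTheory Set Filter Topology
open scoped NNReal ENNReal
open Literature.MathematicalPhysics.KineticTheory.HeatConduction
open Summit.AtomisticToContinuum.FouriersLaw.Theorems.JunctionLocality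

/-- The static input of the assembly, from `pinnedChain_contactCurrentFourthMoment`. -/
theorem farCurrentFourthMoment_holds : FSAssembly.FarCurrentFourthMoment := by
  intro ω₂ lam β γ hω hl hβ _hγ T hT
  obtain ⟨C, _, hC⟩ := pinnedChain_contactCurrentFourthMoment ω₂ lam β γ hω hl.le hβ.le T hT
  exact ⟨C, fun N k _ _ => hC N k⟩

/-- **STUB LC (`stub_lightConeWindow`) of line contact-current-forgetting, crux `NonBallistic` — the registered text
VERBATIM.** -/
theorem stub_lightConeWindow :
    ∀ ω₂ lam β γ : ℝ, 0 < ω₂ → 0 < lam → 0 < β → 0 < γ → ∀ T : ℝ, 0 < T →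
      ∃ t₀ η : ℕ → ℝ, (∀ N, 0 ≤ t₀ N) ∧ Tendsto t₀ atTop atTop ∧
        Tendsto (fun N => η N * t₀ N) atTop (𝓝 0) ∧
        ∀ N : ℕ, 2 ≤ N → ∀ t : ℝ, 0 ≤ t → t ≤ t₀ N →
          |gkEntry (pinnedChain ω₂ lam β γ) N T 0 (N - 2) t| ≤ η N :=
  FSAssembly.stub_lightConeWindow_of_fourthMoment farCurrentFourthMoment_holds

end Summit.AtomisticToContinuum.FouriersLaw.Theorems.NonBallistic

end
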